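import Literature.NumberTheory.Automorphic.AdeleQuotientFourierCoeffBound
import Literature.NumberTheory.Weil1964.AdelicSecondDegreeCharacter
import HarnessLib

/-!
# Fourier coefficients on `𝔸_K ⧸ K` bounded by the sup over a FUNDAMENTAL SET, and the fibre-measure form

Topic `NumberTheory/Automorphic`; namespace `Literature.NumberTheory.Automorphic`.  THEOREMS ONLY (no definition, no instance, no
notation, no named fact, no `sorry`).  Sequel of ★ `AdeleQuotientFourierCoeffBound` (`norm_coeff_le_of_periodic_eq_tsum`: a bounded
`K`-periodic `G : 𝔸_K → ℂ`, `G(x) = Σ_ξ c_ξ ψ(ξ x)` absolutely summable, has `‖c_η‖ ≤ sup ‖G‖`).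

THE (elementary) STATEMENTS [CasselsFrohlichANT1967, Ch. XV §4.1 Thm. 4.1.3 and Cor. 4.1.1 (`𝔸_K = K + D`, `D` relatively compact), §4.2
Lemma 4.2.2; folklore]:

* §1 `exists_isCompact_forall_exists_algebraMap_add_mem` — a COMPACT fundamental set: `∃ C` compact with `∀ x, ∃ ξ ∈ K, ξ + x ∈ C`
  (Tate's `D ⊆ C`); `norm_le_of_periodic_of_forall_mem` — a `K`-periodic function bounded by `M` on a fundamental set is bounded by `M`;
  `periodic_of_eq_tsum` — a function given by an absolutely… (any) series `Σ_ξ c_ξ ψ(ξ x)` IS `K`-periodic (`ψ|_K = 1`);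
  **`norm_coeff_le_of_eq_tsum_of_forall_mem`** — hence `‖c_η‖ ≤ M` as soon as `‖G‖ ≤ M` ON A FUNDAMENTAL SET ONLY (the shape in which
  uniform bounds arrive: `β` in a compact `Kβ ⊆ 𝔸_K`).
* §2 THE FIBRE-MEASURE FORM (currency: Radon measures on `X`, a measurable map `h : X → 𝔸_K`, families `μ₁ μ₂ : K → Measure X` CARRIED BY
  THE FIBRES `h⁻¹{b}`): `integral_comp_mul_eq_mul_integral_of_measure_compl_preimage_eq_zero` (`∫ g(h x) Φ(x) dμ = g(b) ∫ Φ dμ` when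
  `μ((h⁻¹{b})ᶜ) = 0`), and **`norm_integral_sub_mul_integral_le_of_fibre`**: if `β ↦ G β = Σ'_b (∫ ψ(β·h x) Φ x dμ₁_b − κ ∫ ψ(β·h x) Φ x dμ₂_b)`
  with `Σ_b ‖∫ Φ dμ₁_b − κ ∫ Φ dμ₂_b‖ < ∞` and `‖G β‖ ≤ M` for `β` in a fundamental set, then EVERY coefficient obeys
  `‖∫ Φ dμ₁_b − κ ∫ Φ dμ₂_b‖ ≤ M` — Weil's extraction of the `b`-th Fourier coefficient of the bounded tempered measure `E″ = E′ − E`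
  along `P_s(𝔸)/P_s(k) ⊃ 𝔸_K/K` [Weil1965, n° 50–51, proof of Thm. 4, pp. 72–74: «les mesures `μ″_b` … `|μ″_b(…)| ≤ M`»]; the single-family
  form `norm_integral_le_of_fibre`.

Cell `hodgecm-mathlib`, programme P4, ENGINE E-2 (H413), child line `F0_E2SiegelWeilWeilRange`, stub `stub_SW2_siegelWeil` conjunct (iii), row
I-CLOSE letter (BOUND-b) ∕ split-off «COEFF-b» (pen F0P2a-p08 (g4) sheet `SW2-ICLOSE-ASSEMBLY.v0` §1; seat F0P4-p08 (g3)): `μ₁_b = μ̂_b` (theta side,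
(Θ-DEC)), `μ₂_b = μ_b` (Eisenstein side, (E-DEC)), `κ = κ₀ = ν(univ)`, `h = hNorm`, `G β = E″(chirp(β•S_h) Φ_t)`, `M = M_b·(l2Scaling (r₀ D(t)))^{1/2}`
from p07 (g2)'s narrow-ray bound (uniform for `β` in a compact `Kβ` — a fundamental set suffices by §1).  HC_CM is proved only modulo the 7
printed citations until rung 0 closes — nothing here bears on a summit statement.

## References
* [CasselsFrohlichANT1967] J. Tate, *Fourier analysis in number fields and Hecke's zeta-functions*, in J. W. S. Cassels, A. Fröhlich (eds.),
  *Algebraic Number Theory* (1967), Ch. XV, §4.1 Thm. 4.1.3, Cor. 4.1.1; §4.2 Lemma 4.2.2.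
* [Weil1965] A. Weil, *Sur la formule de Siegel dans la théorie des groupes classiques*, Acta Math. 113 (1965) 1–87, n° 50–51 (pp. 72–74).
-/

noncomputable section

open _root_.MeasureTheory _root_.MeasureTheory.Measure Set Filter IsDedekindDomain NumberField
open _root_.Topology
open scoped ENNReal ComplexConjugate

namespace Literature.NumberTheory.Automorphic

/-! ## §1 Bounds on a fundamental set -/

section FundamentalSet

variable (K : Type) [Field K] [NumberField K]
  [MeasurableSpace (adeleQuotient K)] [BorelSpace (adeleQuotient K)]

omit [MeasurableSpace (adeleQuotient K)] [BorelSpace (adeleQuotient K)] in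
/-- **A compact fundamental set for `K` in `𝔸_K`**: there is a compact `C ⊆ 𝔸_K` such that every adele is congruent mod `K` to an element
of `C` (`𝔸_K = K + D` with Tate's `D` relatively compact; take `C ⊇ D` compact). [cite: CasselsFrohlichANT1967, Ch. XV Thm. 4.1.3, Cor. 4.1.1] -/
theorem exists_isCompact_forall_exists_algebraMap_add_mem :
    ∃ C : Set (AdeleRing (𝓞 K) K), IsCompact C ∧ ∀ x : AdeleRing (𝓞 K) K, ∃ ξ : K, algebraMap K (AdeleRing (𝓞 K) K) ξ + x ∈ C := by
  obtain ⟨C, hC, -, hDC⟩ := exists_isCompact_adeleFundamentalDomain_subset K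
  refine ⟨C, hC, fun x => ?_⟩
  obtain ⟨ξ, hξ, -⟩ := existsUnique_add_algebraMap_mem_adeleFundamentalDomain K x
  exact ⟨ξ, hDC hξ⟩

omit [MeasurableSpace (adeleQuotient K)] [BorelSpace (adeleQuotient K)] in
/-- **periodic and bounded on a fundamental set ⇒ bounded**: if `G(ξ + x) = G(x)` for `ξ ∈ K` and `‖G‖ ≤ M` on a set `C` meeting every
class of `𝔸_K ⧸ K`, then `‖G‖ ≤ M` everywhere (`𝔸_K = K + D`). [cite: CasselsFrohlichANT1967, Ch. XV Thm. 4.1.3] -/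
theorem norm_le_of_periodic_of_forall_mem {E : Type*} [SeminormedAddCommGroup E] {G : AdeleRing (𝓞 K) K → E}
    (hper : ∀ (ξ : K) (x : AdeleRing (𝓞 K) K), G (algebraMap K (AdeleRing (𝓞 K) K) ξ + x) = G x)
    {C : Set (AdeleRing (𝓞 K) K)} (hC : ∀ x : AdeleRing (𝓞 K) K, ∃ ξ : K, algebraMap K (AdeleRing (𝓞 K) K) ξ + x ∈ C)
    {M : ℝ} (hM : ∀ x ∈ C, ‖G x‖ ≤ M) (x : AdeleRing (𝓞 K) K) : ‖G x‖ ≤ M := by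
  obtain ⟨ξ, hξ⟩ := hC x
  rw [← hper ξ x]
  exact hM _ hξ

omit [MeasurableSpace (adeleQuotient K)] [BorelSpace (adeleQuotient K)] in
/-- **a series `Σ_ξ c_ξ ψ(ξ x)` in Tate's character is `K`-periodic** (`ψ` is trivial on `K`: ★ `adeleAddChar_algebraMap`; no summability needed,
`tsum` of a non-summable family being `0` termwise-equal families have equal `tsum`). [cite: CasselsFrohlichANT1967, Ch. XV Thm. 4.1.4] -/
theorem periodic_of_eq_tsum {G : AdeleRing (𝓞 K) K → ℂ} {c : K → ℂ}
    (hG : ∀ x, G x = ∑' ξ : K, c ξ * (adeleAddChar K (algebraMap K (AdeleRing (𝓞 K) K) ξ * x) : ℂ))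
    (k : K) (x : AdeleRing (𝓞 K) K) : G (algebraMap K (AdeleRing (𝓞 K) K) k + x) = G x := by
  rw [hG, hG]
  refine tsum_congr fun ξ => ?_
  rw [mul_add, AddChar.map_add_eq_mul, ← (algebraMap K (AdeleRing (𝓞 K) K)).map_mul, adeleAddChar_algebraMap, one_mul]

/-- **COEFFICIENT BOUND FROM A BOUND ON A FUNDAMENTAL SET**: if `G(x) = Σ_ξ c_ξ ψ(ξ x)` with `Σ ‖c_ξ‖ < ∞` and `‖G x‖ ≤ M` for all `x` in a
set `C` meeting every class mod `K` (e.g. a compact fundamental set, §1), then `‖c_η‖ ≤ M` for every `η` (★ `norm_coeff_le_of_periodic_eq_tsum`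
after `periodic_of_eq_tsum` ∕ `norm_le_of_periodic_of_forall_mem`). [cite: CasselsFrohlichANT1967, Ch. XV Lemma 4.2.2]
[cite: Weil1965, n° 50 Thm 4 (pp. 72–74)] -/
theorem norm_coeff_le_of_eq_tsum_of_forall_mem {G : AdeleRing (𝓞 K) K → ℂ} {c : K → ℂ} (hc : Summable fun ξ => ‖c ξ‖)
    (hG : ∀ x, G x = ∑' ξ : K, c ξ * (adeleAddChar K (algebraMap K (AdeleRing (𝓞 K) K) ξ * x) : ℂ))
    {C : Set (AdeleRing (𝓞 K) K)} (hC : ∀ x : AdeleRing (𝓞 K) K, ∃ ξ : K, algebraMap K (AdeleRing (𝓞 K) K) ξ + x ∈ C)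
    {M : ℝ} (hM : ∀ x ∈ C, ‖G x‖ ≤ M) (η : K) : ‖c η‖ ≤ M :=
  norm_coeff_le_of_periodic_eq_tsum K (periodic_of_eq_tsum K hG) hc hG
    (norm_le_of_periodic_of_forall_mem K (periodic_of_eq_tsum K hG) hC hM) η

/-- family form of `norm_coeff_le_of_eq_tsum_of_forall_mem` (one constant `M`, one fundamental set `C`, a family `G_i = Σ_ξ c_i(ξ) ψ(ξ ·)`).
[cite: Weil1965, n° 50 Thm 4 (pp. 72–74)] -/
theorem norm_coeff_le_of_eq_tsum_of_forall_mem_family {ι : Type*} {G : ι → AdeleRing (𝓞 K) K → ℂ} {c : ι → K → ℂ}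
    (hc : ∀ i, Summable fun ξ => ‖c i ξ‖)
    (hG : ∀ i x, G i x = ∑' ξ : K, c i ξ * (adeleAddChar K (algebraMap K (AdeleRing (𝓞 K) K) ξ * x) : ℂ))
    {C : Set (AdeleRing (𝓞 K) K)} (hC : ∀ x : AdeleRing (𝓞 K) K, ∃ ξ : K, algebraMap K (AdeleRing (𝓞 K) K) ξ + x ∈ C)
    {M : ℝ} (hM : ∀ i, ∀ x ∈ C, ‖G i x‖ ≤ M) (i : ι) (η : K) : ‖c i η‖ ≤ M :=
  norm_coeff_le_of_eq_tsum_of_forall_mem K (hc i) (hG i) hC (hM i) η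

end FundamentalSet

/-! ## §2 The fibre-measure form (Weil's `μ″_b`) -/

section Fibre

variable (K : Type) [Field K] [NumberField K] [MeasurableSpace (adeleQuotient K)] [BorelSpace (adeleQuotient K)]
  {X : Type*} [MeasurableSpace X]

omit [MeasurableSpace (adeleQuotient K)] [BorelSpace (adeleQuotient K)] in
/-- **integration against a measure carried by one fibre**: if `μ((h⁻¹{b})ᶜ) = 0` then `∫ g(h x) Φ(x) dμ = g(b) · ∫ Φ dμ` (`h x = b` a.e.).
[cite: Weil1965, n° 44, (35) p. 59] -/
theorem integral_comp_mul_eq_mul_integral_of_measure_compl_preimage_eq_zero (μ : Measure X) (h : X → AdeleRing (𝓞 K) K)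
    (b : AdeleRing (𝓞 K) K) (hμ : μ (h ⁻¹' {b})ᶜ = 0) (g : AdeleRing (𝓞 K) K → ℂ) (Φ : X → ℂ) :
    ∫ x, g (h x) * Φ x ∂μ = g b * ∫ x, Φ x ∂μ := by
  rw [← integral_const_mul]
  refine integral_congr_ae ?_
  have hae : ∀ᵐ x ∂μ, x ∈ h ⁻¹' {b} := mem_ae_iff.2 hμ
  filter_upwards [hae] with x hx
  rw [mem_preimage, mem_singleton_iff] at hx
  rw [hx]

/-- **WEIL'S COEFFICIENT BOUND `|μ″_b(Φ)| ≤ M`, fibre-measure form.**  Let `μ₁ μ₂ : K → Measure X` be two families of measures with `μ_j(b)`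
carried by the fibre `h⁻¹{b}` of a map `h : X → 𝔸_K`, `κ ∈ ℂ`, `Φ : X → ℂ` with `Σ_b ‖∫ Φ dμ₁_b − κ ∫ Φ dμ₂_b‖ < ∞`, and suppose the function
`G(β) = Σ'_b (∫ ψ(β h x) Φ x dμ₁_b − κ ∫ ψ(β h x) Φ x dμ₂_b)` (`ψ` = Tate's character) satisfies `‖G β‖ ≤ M` for `β` in a set meeting every
class of `𝔸_K ⧸ K`.  Then `‖∫ Φ dμ₁_b − κ ∫ Φ dμ₂_b‖ ≤ M` for EVERY `b ∈ K` — `G(β) = Σ_b ψ(b β)·(∫ Φ dμ₁_b − κ ∫ Φ dμ₂_b)` is a bounded absolutely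
convergent Fourier series on `𝔸_K ⧸ K` and its coefficients are bounded by its sup. [cite: Weil1965, n° 50 Thm 4 (pp. 72–74)]
[cite: CasselsFrohlichANT1967, Ch. XV Lemma 4.2.2] -/
theorem norm_integral_sub_mul_integral_le_of_fibre (h : X → AdeleRing (𝓞 K) K) (μ₁ μ₂ : K → Measure X) (κ : ℂ)
    (h₁ : ∀ b : K, μ₁ b (h ⁻¹' {algebraMap K (AdeleRing (𝓞 K) K) b})ᶜ = 0)
    (h₂ : ∀ b : K, μ₂ b (h ⁻¹' {algebraMap K (AdeleRing (𝓞 K) K) b})ᶜ = 0)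
    (Φ : X → ℂ) {G : AdeleRing (𝓞 K) K → ℂ}
    (hG : ∀ β : AdeleRing (𝓞 K) K, G β = ∑' b : K,
      ((∫ x, (adeleAddChar K (β * h x) : ℂ) * Φ x ∂μ₁ b) - κ * ∫ x, (adeleAddChar K (β * h x) : ℂ) * Φ x ∂μ₂ b))
    (hsum : Summable fun b : K => ‖(∫ x, Φ x ∂μ₁ b) - κ * ∫ x, Φ x ∂μ₂ b‖)
    {C : Set (AdeleRing (𝓞 K) K)} (hC : ∀ x : AdeleRing (𝓞 K) K, ∃ ξ : K, algebraMap K (AdeleRing (𝓞 K) K) ξ + x ∈ C)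
    {M : ℝ} (hM : ∀ β ∈ C, ‖G β‖ ≤ M) (b : K) :
    ‖(∫ x, Φ x ∂μ₁ b) - κ * ∫ x, Φ x ∂μ₂ b‖ ≤ M := by
  refine norm_coeff_le_of_eq_tsum_of_forall_mem K (c := fun b : K => (∫ x, Φ x ∂μ₁ b) - κ * ∫ x, Φ x ∂μ₂ b) hsum
    (fun β => ?_) hC hM b
  rw [hG β]
  refine tsum_congr fun b' => ?_
  have e₁ : ∫ x, (adeleAddChar K (β * h x) : ℂ) * Φ x ∂μ₁ b' =
      (adeleAddChar K (β * algebraMap K (AdeleRing (𝓞 K) K) b') : ℂ) * ∫ x, Φ x ∂μ₁ b' :=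
    integral_comp_mul_eq_mul_integral_of_measure_compl_preimage_eq_zero K (μ₁ b') h _ (h₁ b')
      (fun y => (adeleAddChar K (β * y) : ℂ)) Φ
  have e₂ : ∫ x, (adeleAddChar K (β * h x) : ℂ) * Φ x ∂μ₂ b' =
      (adeleAddChar K (β * algebraMap K (AdeleRing (𝓞 K) K) b') : ℂ) * ∫ x, Φ x ∂μ₂ b' :=
    integral_comp_mul_eq_mul_integral_of_measure_compl_preimage_eq_zero K (μ₂ b') h _ (h₂ b')
      (fun y => (adeleAddChar K (β * y) : ℂ)) Φ
  rw [e₁, e₂, mul_comm β]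
  ring

/-- **single-family form**: with `μ_b` carried by `h⁻¹{b}`, `Σ_b ‖∫ Φ dμ_b‖ < ∞` and `‖Σ'_b ∫ ψ(β h x) Φ x dμ_b‖ ≤ M` on a fundamental set,
`‖∫ Φ dμ_b‖ ≤ M` for every `b`. [cite: Weil1965, n° 50 Thm 4 (pp. 72–74)] -/
theorem norm_integral_le_of_fibre (h : X → AdeleRing (𝓞 K) K) (μ : K → Measure X)
    (hμ : ∀ b : K, μ b (h ⁻¹' {algebraMap K (AdeleRing (𝓞 K) K) b})ᶜ = 0)
    (Φ : X → ℂ) {G : AdeleRing (𝓞 K) K → ℂ}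
    (hG : ∀ β : AdeleRing (𝓞 K) K, G β = ∑' b : K, ∫ x, (adeleAddChar K (β * h x) : ℂ) * Φ x ∂μ b)
    (hsum : Summable fun b : K => ‖∫ x, Φ x ∂μ b‖)
    {C : Set (AdeleRing (𝓞 K) K)} (hC : ∀ x : AdeleRing (𝓞 K) K, ∃ ξ : K, algebraMap K (AdeleRing (𝓞 K) K) ξ + x ∈ C)
    {M : ℝ} (hM : ∀ β ∈ C, ‖G β‖ ≤ M) (b : K) :
    ‖∫ x, Φ x ∂μ b‖ ≤ M := by
  have h0 : ∀ b : K, (∫ x, Φ x ∂μ b) - 0 * ∫ x, Φ x ∂μ b = ∫ x, Φ x ∂μ b := fun b => by rw [zero_mul, sub_zero]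
  have key := norm_integral_sub_mul_integral_le_of_fibre K h μ μ 0 hμ hμ Φ (G := G) (fun β => ?_)
    (by simpa only [h0] using hsum) hC hM b
  · simpa only [h0] using key
  · rw [hG β]
    exact tsum_congr fun b' => by rw [zero_mul, sub_zero]

end Fibre

/-! ## §3 The same in the `chirp` currency of `Weil1964/AdelicSecondDegreeCharacter` (`h = q_S`, `G β = Σ'_b (⋯ chirp(β•S)Φ ⋯)`) -/

section Chirp

variable (F : Type) [Field F] [NumberField F] [MeasurableSpace (adeleQuotient F)] [BorelSpace (adeleQuotient F)]
  [MeasurableSpace (AdeleRing (𝓞 F) F)] {n : ℕ}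

omit [MeasurableSpace (adeleQuotient F)] [BorelSpace (adeleQuotient F)] [MeasurableSpace (AdeleRing (𝓞 F) F)] in
/-- `q_{β S}(x) = β · q_S(x)` (the second-degree form is linear in its matrix). [cite: Weil1964, Chap. I n° 2 p. 146] -/
theorem sdForm_smul (β : AdeleRing (𝓞 F) F) (S : Matrix (Fin n) (Fin n) (AdeleRing (𝓞 F) F)) (x : Fin n → AdeleRing (𝓞 F) F) :
    Weil1964.sdForm F (β • S) x = β * Weil1964.sdForm F S x := by
  rw [Weil1964.sdForm_apply, Weil1964.sdForm_apply, Matrix.vecMul_smul, smul_dotProduct, smul_eq_mul]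

omit [MeasurableSpace (adeleQuotient F)] [BorelSpace (adeleQuotient F)] [MeasurableSpace (AdeleRing (𝓞 F) F)] in
/-- `chirp(β•S) Φ (x) = ψ_F(β · q_S(x)) · Φ(x)`: the `β`-family of chirps is the character family `ψ(β h)` along `h = q_S`.
[cite: Weil1964, Chap. I n° 2 p. 146] -/
theorem chirp_smul_matrix_apply (β : AdeleRing (𝓞 F) F) (S : Matrix (Fin n) (Fin n) (AdeleRing (𝓞 F) F))
    (Φ : (Fin n → AdeleRing (𝓞 F) F) → ℂ) (x : Fin n → AdeleRing (𝓞 F) F) :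
    Weil1964.chirp F (β • S) Φ x = (adeleAddChar F (β * Weil1964.sdForm F S x) : ℂ) * Φ x := by
  rw [Weil1964.chirp_apply, Weil1964.sdChar_apply, ← Weil1964.sdForm_apply, sdForm_smul]

/-- **WEIL'S COEFFICIENT BOUND, chirp form** (the letter (BOUND-b) of the E-2 I-CLOSE assembly): two families `μ₁ μ₂ : F → Measure (𝔸_F^n)`
carried by the fibres `q_S⁻¹{b}` of the quadratic form `q_S` (`μ̂_b`, `μ_b` of the theta ∕ Eisenstein sides), `κ ∈ ℂ`, `Φ` with
`Σ_b ‖∫ Φ dμ₁_b − κ ∫ Φ dμ₂_b‖ < ∞`; if `G β = Σ'_b (∫ chirp(β•S)Φ dμ₁_b − κ ∫ chirp(β•S)Φ dμ₂_b)` (the functional `E″` tested against the chirped `Φ`)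
is bounded by `M` for `β` in a fundamental set of `𝔸_F` mod `F` (e.g. a compact `Kβ`), then `‖∫ Φ dμ₁_b − κ ∫ Φ dμ₂_b‖ ≤ M` for every `b ∈ F`.
[cite: Weil1965, n° 50 Thm 4 (pp. 72–74)] [cite: CasselsFrohlichANT1967, Ch. XV Lemma 4.2.2] -/
theorem norm_integral_sub_mul_integral_le_of_fibre_chirp (S : Matrix (Fin n) (Fin n) (AdeleRing (𝓞 F) F))
    (μ₁ μ₂ : F → Measure (Fin n → AdeleRing (𝓞 F) F)) (κ : ℂ)
    (h₁ : ∀ b : F, μ₁ b ((Weil1964.sdForm F S) ⁻¹' {algebraMap F (AdeleRing (𝓞 F) F) b})ᶜ = 0)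
    (h₂ : ∀ b : F, μ₂ b ((Weil1964.sdForm F S) ⁻¹' {algebraMap F (AdeleRing (𝓞 F) F) b})ᶜ = 0)
    (Φ : (Fin n → AdeleRing (𝓞 F) F) → ℂ) {G : AdeleRing (𝓞 F) F → ℂ}
    (hG : ∀ β : AdeleRing (𝓞 F) F, G β = ∑' b : F,
      ((∫ x, Weil1964.chirp F (β • S) Φ x ∂μ₁ b) - κ * ∫ x, Weil1964.chirp F (β • S) Φ x ∂μ₂ b))
    (hsum : Summable fun b : F => ‖(∫ x, Φ x ∂μ₁ b) - κ * ∫ x, Φ x ∂μ₂ b‖)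
    {C : Set (AdeleRing (𝓞 F) F)} (hC : ∀ x : AdeleRing (𝓞 F) F, ∃ ξ : F, algebraMap F (AdeleRing (𝓞 F) F) ξ + x ∈ C)
    {M : ℝ} (hM : ∀ β ∈ C, ‖G β‖ ≤ M) (b : F) :
    ‖(∫ x, Φ x ∂μ₁ b) - κ * ∫ x, Φ x ∂μ₂ b‖ ≤ M := by
  refine norm_integral_sub_mul_integral_le_of_fibre F (Weil1964.sdForm F S) μ₁ μ₂ κ h₁ h₂ Φ (G := G) (fun β => ?_) hsum hC hM b
  rw [hG β]
  simp only [chirp_smul_matrix_apply]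

end Chirp

end Literature.NumberTheory.Automorphic

end
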